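import Literature.NumberTheory.GaloisCohomology.BrauerSumInvCyclicClassPositive
import Literature.NumberTheory.NumberFields.HilbertClassFieldIdelic
import Literature.NumberTheory.Automorphic.QuadraticHeckeCharacterInfiniteIdeles
import Literature.NumberTheory.GaloisCohomology.PoitouTateOddLevelRealPlaces
import HarnessLib

/-!
# The Artin map kills every archimedean idèle of an extension split at the real places

Let `K` be a number field and `L/K` a finite abelian extension inside `K̄` in which every real place
of `K` stays real, i.e. every complex conjugation `c ∈ Γ_K` restricts trivially to `L`.  Then the
Artin map `ψ_{L|K} : 𝕀_K → Gal(L/K)` kills the whole archimedean part `K_∞ˣ × {1}` of the idèle group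
(Tate, Cassels–Fröhlich VII §6.3: `ψ_{L|K}` is the product of the local Artin maps, and at a real place
`v` the local map `ℝˣ → G(L^v/K_v)` is trivial when `L^v = ℝ`; Neukirch VI (5.6)–(5.8)).  In the tree's
dialect (no local Artin maps at the archimedean places) this is assembled from

* `artinIdeleMap_infiniteIdeles_eq_one_of_pos` (`BrauerSumInvCyclicClassPositive.lean`): idèles
  positive at the real places are killed (identity component ⊆ norm group), and
* `artinIdeleMap_infiniteIdeleSingle_neg_one` (`HilbertClassFieldIdelic.lean`, from the archimedean
  clause of Artin reciprocity for characters): `ψ_{L|K}((-1)_w) = c_w|_L`,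

writing an archimedean idèle as the product of its one-place pieces
(`infiniteIdeles_eq_prod_infiniteIdeleSingle`) and each real piece as `(±1)_w · (|u_w|)_w`.

* `artinIdeleMap_infiniteIdeleSingle_eq_one_of_pos`, `artinIdeleMap_infiniteIdeleSingle_eq_one_of_isComplex`
  — one-place pieces positive at a real place, or at a complex place, are killed (any `L`);
* `artinIdeleMap_infiniteIdeleSingle_eq_one_of_restrict` — at a real place `w` whose complex
  conjugations restrict trivially to `L`, EVERY one-place piece `(y)_w` is killed;
* **`artinIdeleMap_infiniteIdeles_eq_one_of_forall_isComplexConjugationAt`** — if all complex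
  conjugations of `Γ_K` restrict trivially to `L`, `ψ_{L|K}((u)_∞) = 1` for every `u ∈ K_∞ˣ`;
* `absRestrictNormalHom_eq_one_of_sq_eq_one_of_ker_eq_layerSubgroup`,
  **`artinIdeleMap_layer_infiniteIdeles_eq_one`** — the case of the layers `K_M` of a
  `ℤ_p`-extension `κ` cut out by a cyclic character with `ker ψ = κ⁻¹(p^M ℤ_p) = Gal(K̄/K_M)`:
  involutions of `Γ_K` lie in every layer subgroup (`ZpExtension.mem_layerSubgroup_of_sq_eq_one`,
  `ℤ_p` is torsion-free), so `ψ_{K_M|K}` kills `K_∞ˣ` — the archimedean hypothesis `hinf` of the cyclic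
  reciprocity law (`sum_localInvariantMap_localization_cupProduct_δ₀_eq_zero`) for the cyclotomic
  killing layers over a number field WITH REAL PLACES (the `2`-primary part of the `∀ K` form of
  `poitouTate_sum_localTatePairing_eq_zero`).

Proof file: theorems only (no definition, no named fact, no instance; D-0026).  HONEST FRAMING:
textbook class field theory bookkeeping; proves no case of BSD.

## References

* J. Tate, *Global class field theory*, Ch. VII of Cassels–Fröhlich (1967), §6.3 (the Artin map is the
  product of the local Artin maps; archimedean components). [CasselsFrohlichANT1967]
* J. Neukirch, *Algebraic Number Theory* (1999), Ch. VI §5 (5.6)–(5.8). [NeukirchANT1999]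
* L. C. Washington, *Introduction to Cyclotomic Fields* (1997), §13.1 (`ℤ_p`-extensions are unramified
  at the infinite places). [Washington1997]

## Tree search

`lean search 'infiniteIdeleSingle_neg_one|infiniteIdeles_eq_one_of_pos|eq_prod_infiniteIdeleSingle'`:
the three inputs above; no prior statement for extensions split at the real places
(`map_infiniteIdeles_eq_one_of_forall_isComplex` in `KummerKeyStep.lean` is the totally complex case
for Hecke characters).
-/

noncomputable section

open Function NumberField IsDedekindDomain Field
open scoped NumberField

namespace Literature.NumberTheory.GaloisCohomology

open Literature.NumberTheory.GaloisRepresentations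
open Literature.NumberTheory.GaloisRepresentations.LocalWeilDatum
open Literature.NumberTheory.NumberFields
open Literature.NumberTheory.Automorphic
open Literature.NumberTheory.EllipticCurves

variable {K : Type} [Field K] [NumberField K]
  (L : IntermediateField K (AlgebraicClosure K)) [FiniteDimensional K L] [IsAbelianGalois K L]
  [NumberField L]

/-! ### §1. One-place archimedean idèles -/

/-- **A one-place archimedean idèle `(y)_w` that is positive at `w` (if `w` is real) is killed by
`ψ_{L|K}`** (any finite abelian `L/K`): all its real components are positive
(`artinIdeleMap_infiniteIdeles_eq_one_of_pos`). [cite: NeukirchANT1999, Ch. VI §5 Cor. (5.8)] -/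
theorem artinIdeleMap_infiniteIdeleSingle_eq_one_of_pos (w : InfinitePlace K) (y : (w.Completion)ˣ)
    (hy : ∀ hw : w.IsReal, 0 < InfinitePlace.Completion.extensionEmbeddingOfIsReal hw (y : w.Completion)) :
    artinIdeleMap L artinReciprocity_character_holds (infiniteIdeleSingle w y) = 1 := by
  classical
  change artinIdeleMap L artinReciprocity_character_holds (infiniteIdeles K _) = 1
  refine artinIdeleMap_infiniteIdeles_eq_one_of_pos L _ fun w' hw' => ?_
  change 0 < InfinitePlace.Completion.extensionEmbeddingOfIsReal hw'
    (Pi.mulSingle (M := fun v : InfinitePlace K => v.Completion) w (y : w.Completion) w')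
  by_cases h : w' = w
  · subst h
    rw [Pi.mulSingle_eq_same]
    exact hy hw'
  · rw [Pi.mulSingle_eq_of_ne (M := fun v : InfinitePlace K => v.Completion) h, map_one]
    exact one_pos

/-- **At a complex place every one-place archimedean idèle is killed by `ψ_{L|K}`** (any `L`).
[cite: NeukirchANT1999, Ch. VI §5 Cor. (5.8)] -/
theorem artinIdeleMap_infiniteIdeleSingle_eq_one_of_isComplex {w : InfinitePlace K} (hw : w.IsComplex)
    (y : (w.Completion)ˣ) :
    artinIdeleMap L artinReciprocity_character_holds (infiniteIdeleSingle w y) = 1 :=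
  artinIdeleMap_infiniteIdeleSingle_eq_one_of_pos L w y fun hw' =>
    absurd hw' (InfinitePlace.not_isReal_iff_isComplex.mpr hw)

omit [NumberField K] in
/-- The real embedding of `K_w` does not vanish on units. [folklore] -/
private theorem extensionEmbeddingOfIsReal_units_ne_zero {w : InfinitePlace K} (hw : w.IsReal) (y : (w.Completion)ˣ) :
    InfinitePlace.Completion.extensionEmbeddingOfIsReal hw (y : w.Completion) ≠ 0 := by
  rw [map_ne_zero]
  exact y.ne_zero

/-- **At a real place `w` all of whose complex conjugations restrict trivially to `L`, every one-place
archimedean idèle `(y)_w` is killed by `ψ_{L|K}`**: `(y)_w = (±1)_w · (|y|)_w`, the positive piece is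
killed (`artinIdeleMap_infiniteIdeleSingle_eq_one_of_pos`) and `ψ_{L|K}((-1)_w) = c_w|_L = 1`
(`artinIdeleMap_infiniteIdeleSingle_neg_one`).  This is the triviality of the local Artin map at a real
place that splits in `L`. [cite: CasselsFrohlichANT1967, Ch. VII §6.3] -/
theorem artinIdeleMap_infiniteIdeleSingle_eq_one_of_restrict {w : InfinitePlace K} (hw : w.IsReal)
    (hL : ∀ c : absoluteGaloisGroup K, IsComplexConjugationAt hw c → absRestrictNormalHom L c = 1)
    (y : (w.Completion)ˣ) :
    artinIdeleMap L artinReciprocity_character_holds (infiniteIdeleSingle w y) = 1 := by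
  set s : ℝ := InfinitePlace.Completion.extensionEmbeddingOfIsReal hw (y : w.Completion) with hs
  have hs0 : s ≠ 0 := extensionEmbeddingOfIsReal_units_ne_zero hw y
  rcases lt_or_gt_of_ne hs0 with hneg | hpos
  · -- `y = (-1) · (-y)` with `-y` positive at `w`
    have hy : y = -1 * -y := by rw [neg_one_mul, neg_neg]
    obtain ⟨c, hc⟩ : ∃ c : absoluteGaloisGroup K, IsComplexConjugationAt hw c :=
      Literature.NumberTheory.GaloisRepresentations.exists_isComplexConjugation (K := K)
        (NumberField.InfinitePlace.embedding_of_isReal hw)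
    rw [hy, map_mul, map_mul, artinIdeleMap_infiniteIdeleSingle_neg_one L hw hc, hL c hc, one_mul]
    refine artinIdeleMap_infiniteIdeleSingle_eq_one_of_pos L w (-y) fun hw' => ?_
    rw [Units.val_neg, map_neg]
    exact neg_pos.mpr hneg
  · exact artinIdeleMap_infiniteIdeleSingle_eq_one_of_pos L w y fun _ => hpos

/-! ### §2. Extensions split at every real place -/

/-- **If every complex conjugation of `Γ_K` restricts trivially to `L`, the Artin map `ψ_{L|K}` kills
every archimedean idèle `(u)_∞ = (u, 1)`, `u ∈ K_∞ˣ`** (Tate VII §6.3: the archimedean local Artin maps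
of an extension split at the real places are trivial).  Write `(u)_∞ = ∏_w (u_w)_w`
(`infiniteIdeles_eq_prod_infiniteIdeleSingle`) and use §1 place by place.
[cite: CasselsFrohlichANT1967, Ch. VII §6.3] [cite: NeukirchANT1999, Ch. VI §5 Cor. (5.8)] -/
theorem artinIdeleMap_infiniteIdeles_eq_one_of_forall_isComplexConjugationAt
    (hL : ∀ (w : InfinitePlace K) (hw : w.IsReal) (c : absoluteGaloisGroup K),
      IsComplexConjugationAt hw c → absRestrictNormalHom L c = 1)
    (u : (InfiniteAdeleRing K)ˣ) :
    artinIdeleMap L artinReciprocity_character_holds (infiniteIdeles K u) = 1 := by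
  classical
  rw [infiniteIdeles_eq_prod_infiniteIdeleSingle u, ← MonoidHom.mem_ker]
  refine Subgroup.prod_mem _ fun w _ => ?_
  rw [MonoidHom.mem_ker]
  rcases w.isReal_or_isComplex with hw | hw
  · exact artinIdeleMap_infiniteIdeleSingle_eq_one_of_restrict L hw (hL w hw) _
  · exact artinIdeleMap_infiniteIdeleSingle_eq_one_of_isComplex L hw _

/-- Variant for a principal archimedean idèle `(b)_∞`, `b ∈ Kˣ` — the hypothesis `hinf` of the cyclic
reciprocity law `sum_localInvariantMap_localization_cupProduct_δ₀_eq_zero`, for `L` split at the real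
places and ARBITRARY `b`. [cite: CasselsFrohlichANT1967, Ch. VII §6.3] -/
theorem artinIdeleMap_infiniteIdeles_globalToInfiniteUnits_eq_one_of_forall_isComplexConjugationAt
    (hL : ∀ (w : InfinitePlace K) (hw : w.IsReal) (c : absoluteGaloisGroup K),
      IsComplexConjugationAt hw c → absRestrictNormalHom L c = 1)
    (b : Kˣ) :
    artinIdeleMap L artinReciprocity_character_holds (infiniteIdeles K (globalToInfiniteUnits K b)) = 1 :=
  artinIdeleMap_infiniteIdeles_eq_one_of_forall_isComplexConjugationAt L hL _

/-! ### §3. Layers of a `ℤ_p`-extension (cyclotomic killing layers) -/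

omit [NumberField K] [FiniteDimensional K L] [NumberField L] in
/-- An element of the kernel of a cyclic character `ψ` with `ker ψ = Gal(K̄/L)` restricts trivially to
`L`. [folklore] -/
private theorem absRestrictNormalHom_eq_one_of_mem_ker {n : ℕ} (ψ : CyclicCharacter (absoluteGaloisGroup K) n)
    (hker : ψ.ker = galFixing K L) {c : absoluteGaloisGroup K} (hc : c ∈ ψ.ker) :
    absRestrictNormalHom L c = 1 := by
  rw [absRestrictNormalHom_eq_one_iff]
  rw [hker] at hc
  exact hc

omit [NumberField K] [FiniteDimensional K L] [NumberField L] in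
/-- **Complex conjugations restrict trivially to every layer of a `ℤ_p`-extension**: for a
`ℤ_p`-extension `κ` of `K` and a cyclic character `ψ` with `ker ψ = κ⁻¹(p^M ℤ_p) = Gal(K̄/L)` (the layer
`L = K_M`), every `c ∈ Γ_K` with `c² = 1` — in particular every complex conjugation at a real place —
satisfies `c|_L = 1` (`ZpExtension.mem_layerSubgroup_of_sq_eq_one`: `ℤ_p` is torsion-free).  The layers of
a `ℤ_p`-extension are split at all real places. [cite: Washington1997, §13.1] -/
theorem absRestrictNormalHom_eq_one_of_sq_eq_one_of_ker_eq_layerSubgroup {p : ℕ} [Fact p.Prime]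
    (κ : ZpExtension K p) (M : ℕ) {n : ℕ} (ψ : CyclicCharacter (absoluteGaloisGroup K) n)
    (hkerV : ψ.ker = κ.layerSubgroup M) (hkerL : ψ.ker = galFixing K L)
    {c : absoluteGaloisGroup K} (hc : c ^ 2 = 1) : absRestrictNormalHom L c = 1 :=
  absRestrictNormalHom_eq_one_of_mem_ker L ψ hkerL (by
    rw [hkerV]; exact ZpExtension.mem_layerSubgroup_of_sq_eq_one κ hc M)

omit [NumberField K] in
/-- A complex conjugation at a real place is an involution: `c² = 1`. [folklore] -/
private theorem sq_eq_one_of_isComplexConjugationAt {w : InfinitePlace K} {hw : w.IsReal} {c : absoluteGaloisGroup K}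
    (hc : IsComplexConjugationAt hw c) : c ^ 2 = 1 :=
  IsComplexConjugation.sq_eq_one hc

/-- **The Artin map of a layer of a `ℤ_p`-extension kills every archimedean idèle**: with `κ`, `M`,
`ψ`, `L = K_M` as above, `ψ_{L|K}((u)_∞) = 1` for all `u ∈ K_∞ˣ` — the hypothesis `hinf` of the cyclic
reciprocity law for the cyclotomic killing layers over an arbitrary number field (possibly with real
places). [cite: CasselsFrohlichANT1967, Ch. VII §6.3] [cite: Washington1997, §13.1] -/
theorem artinIdeleMap_layer_infiniteIdeles_eq_one {p : ℕ} [Fact p.Prime]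
    (κ : ZpExtension K p) (M : ℕ) {n : ℕ} (ψ : CyclicCharacter (absoluteGaloisGroup K) n)
    (hkerV : ψ.ker = κ.layerSubgroup M) (hkerL : ψ.ker = galFixing K L) (u : (InfiniteAdeleRing K)ˣ) :
    artinIdeleMap L artinReciprocity_character_holds (infiniteIdeles K u) = 1 :=
  artinIdeleMap_infiniteIdeles_eq_one_of_forall_isComplexConjugationAt L
    (fun _ _ _ hc => absRestrictNormalHom_eq_one_of_sq_eq_one_of_ker_eq_layerSubgroup L κ M ψ hkerV hkerL
      (sq_eq_one_of_isComplexConjugationAt hc)) u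

end Literature.NumberTheory.GaloisCohomology

end
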